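/-
Copyright (c) 2026 the pub-hodgecm-mathlib formalisation cell (harness21).  Prover seat hodgecm-mathlib-LH4-p16 (g3) (K6 desk), req620 Track A «(D-RAM) FOUR-FRAME» squad
((β₂) road (R-36), the K6 road, WORD #25∕#26 piece (δ) «A1-D0»: the affine label dictionary at GAP ZERO — the δ = 0 twin of ★ p864943 `…AffineLabelOnShellIff` (LH4-p15 (g3)) and the
any-parity twin of ★ p863973 `…DiagonalCellCoordsDeltaZero.exists_affineLabel_of_coords_of_gap_zero` (LH4-p06 (g9))), 2026-09-05.
-/
import Summits.HodgeConjecture.HodgeConjecture.Theorems.F0P3cDyRamAffineLabelOnShellIff       -- ★ p864943 (LH4-p15 (g3)): the on-shell dictionary; brings ★ p862927's toolkit (`v_refSkew_eq`, `v_fst_eq_of_fixed_coords`, ★ Lit `normSign_eq_of_near`)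
import HarnessLib

/-!
# Crux `H413`, line LH4 «(D-RAM) FOUR-FRAME» — the (β₂) road (R-36), K6 road, piece (δ) of the δ = 0 corner: «THE AFFINE LABEL AT GAP ZERO — UNIT SLOPE, UNIT LETTER AS AN
# EQUIVALENCE, AND THE DICTIONARY OFF THE X-DIGIT», ANY PARITY OF `d`

Cell `hodgecm-mathlib` (D-0151), FLOOR 0, crux item H413 = `stmt-HodgeConjecture-24833`, route of record `HCCMUnconditional`; squad F0∕P3c∕LH4; lane
`--supports stmt-HodgeConjecture-24833 --as helper` (count-neutral; pays NO tier-0 row).  THEOREMS ONLY (no `def`, no instance, no notation, no `sorry`, default heartbeats);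
★-only imports; states NO law; (β₂) stays a HYPOTHESIS.
THE REGIME.  On a live row `2b + d%2 = m` with gap `δ = jl − m = 0` (the lone, diagonal cell `(b, b)` of an `N = 0` window of ‹CORE.v1›∕‹CORE-ODD.v1›) the normalised coordinates
`â′ = (μ_a + μ_bR₀)∕(ϖσϖ)^b`, `b̂′ = μ_bγ₀∕(ϖσϖ)^b` of the row have `|b̂′| = |ϖ|^{d%2}` EXACTLY and `|â′| ≤ |ϖ|^{d%2}` only (the `λ`-coordinate is the main term; ★ p863973's
`|B̂| = 1 ≥ |Â|` in the K7 currency) — the on-shell dictionaries ★ p864616∕p864854∕p864943 all assume `|â′| = |ϖ|^{d%2}` and read the shell `|â′ + b̂′V| = |â′|`, which is the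
WRONG set when `|â′| < |b̂′|`.  THIS FILE, ONE theorem:
* HEAD `exists_affineLabel_of_coords_gapZero` — for `|â| ≤ |ϖ|^{d%2}`, `|b̂| = |ϖ|^{d%2}` (ANY parity of `d`; ★ p863973 is `d` even, `|t₊| = 1`) there are `σ`-fixed `α₁, γ₁` with
  `|α₁| ≤ 1`, `|γ₁| = 1` (leading Eisenstein coefficients of `â∕t₊`, `b̂∕t₊`) such that for a `σ`-fixed integral digit `V`: `|â + b̂V| = |b̂| ↔ |α₁ + γ₁V| = 1` (the NON-X digits
  are exactly the unit labels; the X-digit `V ≡ −α₁∕γ₁` is where the scalar drops), and ON the non-X digits the dictionary `ω(f) = ω(T̂)·ω(α₁ + γ₁V)` for every `σ`-fixed `f` with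
  `|T(â + b̂V) − f·t₊| ≤ |ϖ|^{m⋆}` (★ p864616's clause with the guard `|â + b̂V| = |b̂|`).
  Proof = ★ p864943's token for token with `|â∕t₊| ≤ 1` (so `|α₁| ≤ 1`) and the quotient taken by `|b̂| = |t₊|`.
CONSUMER: (δ) HEAD `…RowDiagChartLettersGapZero.exists_rowDiagChart_letters_gapZero` (this seat; interface `F0/P3c/LH4/LH4-p16/g3/A1-D0.interface.v1.LH4p16g3.lean.txt`), thence
(α) LH4-p12 (g10)'s F1b-D0 and (γ) the δ = 0 top-cell composer.
HONEST LABEL.  Count-neutral valuation bookkeeping; nothing printed is asserted; no census law is stated; ‹D0›∕‹CORE›∕‹CORE-ODD›∕β₂ `stub_law_cleanSgn₂` UNPROVED; `HC_CM` is proved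
only modulo the 7 printed citations (2 remaining named inputs: hLiu418 = `stmt-HodgeConjecture-24832`, h413 = `stmt-HodgeConjecture-24833`) until rung 0 closes.
## References
* [Serre1979] J.-P. Serre, *Local Fields*, GTM 67 (1979): Ch. I §6 Prop. 18; Ch. V §3 Cor. 3 pp. 85–87; Ch. XIV §2–§3.
* [Rogawski1990] J. D. Rogawski, *Automorphic Representations of Unitary Groups in Three Variables*, Ann. of Math. Stud. 123 (1990): §4.9 Prop. 4.9.1 (b) p. 55.
-/

set_option autoImplicit false

noncomputable section

namespace Summit.HodgeConjecture.HodgeConjecture.Cruxes.H413.F0P3cDyRamAffineLabelGapZero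

open scoped Valued WithZero
open WithZero
open Literature.NumberTheory.Automorphic.UnitaryThreeFourFrame (IsRamifiedQuadraticDatum normSign)
open Literature.NumberTheory.LocalFields (exists_fixed_coords_of_map_ne v_fixed_add_fixed_mul_eq_max)
open Literature.NumberTheory.LocalFields.WildQuadraticDatum (v_varpi_pow even_log_v_of_fixed map_varpi_ne normSign_eq_of_near normSign_mul_of_fixed)
open Summit.HodgeConjecture.HodgeConjecture.Cruxes.H413.F0P3cDyRamFourFramePieces (mstarOfRecord)
open Summit.HodgeConjecture.HodgeConjecture.Cruxes.H413.F0P3cDyRamLabelShellFlipCardTwo (v_refSkew_eq)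
open Summit.HodgeConjecture.HodgeConjecture.Cruxes.H413.F0P3cDyRamDiagonalCellAffineLabel (v_fst_eq_of_fixed_coords)

variable {K : Type} [Field K] [Valued K ℤᵐ⁰] {σ : K →+* K} {ϖ : K} {d t : ℕ}

/-- **HEAD — «THE AFFINE LABEL AT GAP ZERO».**  At a complete sheet datum (ANY parity of `d`), for `|â| ≤ |ϖ|^{d%2}` and `|b̂| = |ϖ|^{d%2}` there are `σ`-fixed `α₁, γ₁` with `|α₁| ≤ 1`,
`|γ₁| = 1` such that a `σ`-fixed integral digit `V` satisfies `|â + b̂V| = |b̂|` iff its affine label `α₁ + γ₁V` is a UNIT (the complement of the X-digit), and on those digits the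
dictionary `ω(f) = ω(T̂)·ω(α₁ + γ₁V)` holds (★ p864616's clause with the guard `|â + b̂V| = |b̂|`).  The δ = 0 ∕ any-parity twin of ★ p864943 and ★ p863973 §2.
[cite: Serre1979, Ch. I §6 Prop. 18] [cite: Serre1979, Ch. V §3 Cor. 3 pp. 85–87] [cite: Serre1979, Ch. XIV §2–§3] [cite: Rogawski1990, §4.9 Prop. 4.9.1 (b) p. 55] -/
theorem exists_affineLabel_of_coords_gapZero [CompleteSpace K] [Finite 𝓀[K]] (hD : IsRamifiedQuadraticDatum σ ϖ d t)
    {â bh : K} (hâ : Valued.v â ≤ Valued.v ϖ ^ (d % 2)) (hbh : Valued.v bh = Valued.v ϖ ^ (d % 2)) :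
    ∃ α₁ γ₁ : K, σ α₁ = α₁ ∧ Valued.v α₁ ≤ 1 ∧ σ γ₁ = γ₁ ∧ Valued.v γ₁ = 1 ∧
      (∀ V : K, σ V = V → Valued.v V ≤ 1 → (Valued.v (â + bh * V) = Valued.v bh ↔ Valued.v (α₁ + γ₁ * V) = 1)) ∧
      ∀ (T V f : K), σ T = T → Valued.v T = 1 → σ V = V → Valued.v V ≤ 1 → σ f = f → Valued.v (â + bh * V) = Valued.v bh →
        Valued.v (T * (â + bh * V) - f * ((ϖ - σ ϖ) * ((ϖ * σ ϖ) ^ ((d - d % 2) / 2))⁻¹)) ≤ Valued.v ϖ ^ mstarOfRecord d →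
        normSign σ f = normSign σ T * normSign σ (α₁ + γ₁ * V) := by
  -- adapted from ★ p864943 `…AffineLabelOnShellIff.exists_affineLabel_of_coords_onShell_iff` (LH4-p15 (g3) over LH4-p12 (g9)): `|â∕t₊| ≤ 1` only, quotients by `|b̂| = |t₊|`
  obtain ⟨hσσ, hvσ, hϖ, hfix, hdd, hd1, ht⟩ := id hD
  have hvt : Valued.v ((ϖ - σ ϖ) * ((ϖ * σ ϖ) ^ ((d - d % 2) / 2))⁻¹) = Valued.v ϖ ^ (d % 2) := v_refSkew_eq hvσ hϖ hdd
  have hfix' : ∀ c : K, σ c = c → c ≠ 0 → Even (log (Valued.v c)) := fun c hc hc0 => even_log_v_of_fixed hfix c hc hc0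
  have hvϖ0 : Valued.v ϖ ≠ 0 := by rw [hϖ]; exact exp_ne_zero
  have hϖle : Valued.v ϖ ≤ 1 := by rw [hϖ, ← exp_zero]; exact exp_le_exp.2 (by norm_num)
  have hϖσ : σ ϖ ≠ ϖ := map_varpi_ne hϖ hdd
  set tp : K := (ϖ - σ ϖ) * ((ϖ * σ ϖ) ^ ((d - d % 2) / 2))⁻¹ with htp
  have hvt0 : Valued.v tp ≠ 0 := by rw [hvt]; exact pow_ne_zero _ hvϖ0
  have htp0 : tp ≠ 0 := (Valuation.ne_zero_iff _).1 hvt0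
  have hbh0 : Valued.v bh ≠ 0 := by rw [hbh]; exact pow_ne_zero _ hvϖ0
  obtain ⟨α₁, y₁, hα₁, hy₁, hα⟩ := exists_fixed_coords_of_map_ne hσσ hϖσ (â / tp)
  obtain ⟨γ₁, y₂, hγ₁, hy₂, hγ⟩ := exists_fixed_coords_of_map_ne hσσ hϖσ (bh / tp)
  -- sizes: `|α₁| ≤ |â∕t₊| ≤ 1` (★ `v_fixed_add_fixed_mul_eq_max`), `|γ₁| = 1` (`|b̂∕t₊| = 1`, ★ `v_fst_eq_of_fixed_coords` at `n := 0`)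
  have hα1 : Valued.v α₁ ≤ 1 := by
    have hmax : Valued.v (â / tp) = max (Valued.v α₁) (Valued.v y₁ * exp (-1 : ℤ)) := by rw [hα]; exact v_fixed_add_fixed_mul_eq_max hfix' hϖ hα₁ hy₁
    have hle : Valued.v (â / tp) ≤ 1 := by rw [map_div₀, hvt]; exact div_le_one_of_le₀ hâ zero_le
    exact (le_max_left _ _).trans (hmax.symm.le.trans hle)
  have hγ1 : Valued.v γ₁ = 1 := by
    have h := v_fst_eq_of_fixed_coords hD hγ₁ hy₂ (n := 0) (by rw [← hγ, map_div₀, hbh, hvt, div_self (pow_ne_zero _ hvϖ0)]; norm_num)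
    rw [h]; norm_num
  -- the decomposition `(â + b̂V)∕t₊ = (α₁ + γ₁V) + (y₁ + y₂V)·ϖ`
  have hdec0 : ∀ V : K, (â + bh * V) / tp = (α₁ + γ₁ * V) + (y₁ + y₂ * V) * ϖ := by
    intro V
    have e1 : â = (α₁ + y₁ * ϖ) * tp := by rw [← hα, div_mul_cancel₀ â htp0]
    have e2 : bh = (γ₁ + y₂ * ϖ) * tp := by rw [← hγ, div_mul_cancel₀ bh htp0]
    rw [e1, e2]; field_simp; ring
  -- THE UNIT LETTER AS AN EQUIVALENCE (the shell is read against `|b̂|`, the exact coordinate)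
  have hiff : ∀ V : K, σ V = V → Valued.v V ≤ 1 → (Valued.v (â + bh * V) = Valued.v bh ↔ Valued.v (α₁ + γ₁ * V) = 1) := by
    intro V hσV hV1
    have hσg : σ (α₁ + γ₁ * V) = α₁ + γ₁ * V := by rw [map_add, map_mul, hα₁, hγ₁, hσV]
    have hσY : σ (y₁ + y₂ * V) = y₁ + y₂ * V := by rw [map_add, map_mul, hy₁, hy₂, hσV]
    have hYϖ1 : Valued.v (y₁ + y₂ * V) * exp (-1 : ℤ) ≠ 1 := by
      intro h1
      by_cases hY0 : y₁ + y₂ * V = 0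
      · rw [hY0, map_zero, zero_mul] at h1; exact zero_ne_one h1
      · obtain ⟨n, hn⟩ := hfix _ hσY hY0
        rw [hn, ← exp_add, ← exp_zero, exp_inj] at h1
        omega
    -- `|(â + b̂V)∕t₊| = max |α₁ + γ₁V| (|y₁ + y₂V|·|ϖ|)` and `|(â + b̂V)∕t₊| = |â + b̂V|∕|b̂|`
    have hquot : Valued.v ((â + bh * V) / tp) = max (Valued.v (α₁ + γ₁ * V)) (Valued.v (y₁ + y₂ * V) * exp (-1 : ℤ)) := by
      rw [hdec0, v_fixed_add_fixed_mul_eq_max hfix' hϖ hσg hσY]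
    have hquot' : Valued.v ((â + bh * V) / tp) = Valued.v (â + bh * V) / Valued.v bh := by rw [map_div₀, hvt, hbh]
    constructor
    · intro hshell
      have h1 : max (Valued.v (α₁ + γ₁ * V)) (Valued.v (y₁ + y₂ * V) * exp (-1 : ℤ)) = 1 := by rw [← hquot, hquot', hshell, div_self hbh0]
      rcases max_choice (Valued.v (α₁ + γ₁ * V)) (Valued.v (y₁ + y₂ * V) * exp (-1 : ℤ)) with h | h
      · rw [h] at h1; exact h1
      · rw [h] at h1; exact absurd h1 hYϖ1
    · intro hunit
      -- `|â + b̂V| ≤ |b̂|` always (`|â| ≤ |ϖ|^{d%2} = |b̂|`, `|V| ≤ 1`), so the quotient is `≤ 1`; it is `≥ |α₁ + γ₁V| = 1`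
      have hle : Valued.v (â + bh * V) ≤ Valued.v bh := by
        refine (Valuation.map_add _ _ _).trans (max_le (hâ.trans hbh.symm.le) ?_)
        rw [Valuation.map_mul]; exact mul_le_of_le_one_right' hV1
      have hq1 : Valued.v ((â + bh * V) / tp) ≤ 1 := by rw [hquot']; exact div_le_one_of_le₀ hle zero_le
      have hq2 : 1 ≤ Valued.v ((â + bh * V) / tp) := by rw [hquot, ← hunit]; exact le_max_left _ _
      have hq : Valued.v (â + bh * V) / Valued.v bh = 1 := by rw [← hquot']; exact le_antisymm hq1 hq2
      rwa [div_eq_one_iff_eq hbh0] at hq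
  refine ⟨α₁, γ₁, hα₁, hα1, hγ₁, hγ1, hiff, fun T V f hσT hT1 hσV hV1 hσf hshell hsf => ?_⟩
  -- the dictionary clause, as in ★ p864854 ∕ ★ p864943
  have hT0 : T ≠ 0 := fun h0 => by rw [h0, map_zero] at hT1; exact zero_ne_one hT1
  set f₀ : K := T * (α₁ + γ₁ * V) with hf₀
  set Y : K := T * (y₁ + y₂ * V) with hY
  have hσf₀ : σ f₀ = f₀ := by rw [hf₀, map_mul, map_add, map_mul, hσT, hα₁, hγ₁, hσV]
  have hσY : σ Y = Y := by rw [hY, map_mul, map_add, map_mul, hσT, hy₁, hy₂, hσV]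
  have hdec : T * (â + bh * V) / tp = f₀ + Y * ϖ := by rw [mul_div_assoc, hdec0, hf₀, hY]; ring
  have hf₀1 : Valued.v f₀ = 1 := by rw [hf₀, Valuation.map_mul, hT1, (hiff V hσV hV1).1 hshell, one_mul]
  have hnear : Valued.v (f₀ - f) ≤ Valued.v ϖ ^ (2 * d - 1) := by
    have h1 : Valued.v (T * (â + bh * V) / tp - f) ≤ Valued.v ϖ ^ (2 * d - 1) := by
      have e : T * (â + bh * V) / tp - f = (T * (â + bh * V) - f * tp) / tp := by field_simp
      rw [e, map_div₀, hvt, div_le_iff₀ (zero_lt_iff.2 (pow_ne_zero _ hvϖ0)), ← pow_add]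
      refine hsf.trans (le_of_eq ?_)
      simp only [mstarOfRecord]; congr 1; omega
    rw [hdec] at h1
    have e2 : f₀ + Y * ϖ - f = (f₀ - f) + Y * ϖ := by ring
    rw [e2, v_fixed_add_fixed_mul_eq_max hfix' hϖ (by rw [map_sub, hσf₀, hσf]) hσY] at h1
    exact (le_max_left _ _).trans h1
  rw [normSign_eq_of_near hD hσf₀ hσf hf₀1 (n := 2 * d - 1) le_rfl hnear, hf₀]
  have hαV0 : α₁ + γ₁ * V ≠ 0 := fun h0 => by
    rw [hf₀, h0, mul_zero, map_zero] at hf₀1; exact zero_ne_one hf₀1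
  exact normSign_mul_of_fixed hD hσT (by rw [map_add, map_mul, hα₁, hγ₁, hσV]) hT0 hαV0

end Summit.HodgeConjecture.HodgeConjecture.Cruxes.H413.F0P3cDyRamAffineLabelGapZero

end
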